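/-
Copyright: the b2b-balaban T⁴-continuum CRUX team, row NE7b OWNER lineage `t4-ne7b-p1` (gen 130). Project licence.
-/
import Summits.QuantumFields.BalabanUV.T4Continuum.Spine.NE7b.SupLinePointwise

/-!
# THE STEP ALONG A LINE OF EXTERNAL FIELDS, II — `Z`, `Z′`, `Z″` ARE DIFFERENTIABLE (THE STEP IS `C³` ALONG LINES): for `C³` remainders
# with the letters `−κ₀u² ≤ w`, `|w′| ≤ κ₁|u|`, `|w″| ≤ κ₂`, `|w‴| ≤ κ₃` and `Γ ⪯ γ_op·1` with `(2κ₀(1+τ)+4δ)γ_op ≤ θ < 1`, along every line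
# `ψ₀ + t·h`, `Z(t) = ∫e^{−V_t}dN(0,Γ)`, `V_t(ω) = Σ_{x∈Y}w_x(ω_x + (ψ₀,x + t h_x))`:
#   `Z′(t₀) = ∫e^{−V}(−A)`,  `(∫e^{−V}(−A))′(t₀) = ∫e^{−V}(A² − B)`,  `(∫e^{−V}(A² − B))′(t₀) = ∫e^{−V}(−A³ + 3AB − C)`
# at EVERY `t₀` (`A = Σw′h`, `B = Σw″h²`, `C = Σw‴h³` at `t₀`), each derivative integrand integrable — three dominated differentiations
# under (336a)'s common Gaussian dominator: the analytic half of the THIRD-ORDER letter of the next potential `W⁺ = −log Z` along lines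
# ((log Z)‴ = Z‴∕Z − 3Z′Z″∕Z² + 2(Z′∕Z)³ is the successor's bookkeeping) (row NE7b, node U5c; (336a)∕(313)∕(297) BY NAME; [folklore])

Cell `pub-balaban`, sub-cell `t4`, spine estimate NE7b (`T4WeightBudget.RelWeightBound`; the cell's OWN estimate — NOT PRINTED in
[Bałaban 1983–89], NOT PROVED).  Crux-route work under `Spine/NE7b/` by the row OWNER (`t4-ne7b-p1` gen 130, file (336b)) under FREEZE
(0)'s crux-prover clause, on § [NE7bP1-G130-HANDOFF] NEXT (3)(a); NOTHING of Bałaban's is named as a Lean object, valued or asserted; no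
`T4Continuum/Support` leaf typed; no `def`, no notation; zero `sorry`.  Imports (BY NAME): the OWNER's (336a) `…SupLinePointwise`
(`hasDerivAt_lineZ0∕Z1∕Z2`, `third_domination`), (313) (`integrable_domination`, `mul_opBound_le_of_le`), (297) (`integrable_exp_neg`);
Mathlib's `hasDerivAt_integral_of_dominated_loc_of_deriv_le`.

WHAT IS PROVED ([folklore]): §1 `aestronglyMeasurable_line` (the four integrands are measurable), `norm_deriv_line_le` (the three derivative
integrands are under (336a)'s dominator on `|t − t₀| ≤ 1`); §2 THE END **`hasDerivAt_lineZ`**, **`hasDerivAt_lineZ'`**, **`hasDerivAt_lineZ''`**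
(each: integrability of the derivative integrand ∧ the `HasDerivAt`); §3 toy.

HONEST (what this is NOT).  The three derivatives of `Z` along a line; the quotient bookkeeping for `(log Z)‴` and the tilted letters that
bound it (⟹ the cubic letter of the next remainder, O(1) on the same sites — no constant improvement without blocking) are the successor's;
scalar skeleton ((A3), NC-NE7b-α UNRULED); nothing of Bałaban's asserted.  BY-NAME EFFECT ON THE WALL: NONE.  NE7b NOT PRINTED ∕ NOT PROVED;
spine PROVED 0∕9; rung (B)+1 — the programme's measures remain FINITE-torus statements; NOT the mass gap, NOT Clay.  HONEST DEPENDENCY: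
continuum YM on T⁴ ⇐ BetaPertH ∧ nine spine estimates (0∕9 proved); BetaPertH ⇐ (D1) ∧ (D4) ∧ CAP+tail; G-an2-4 gates asym, D1 and NE2∕3∕4.
-/

set_option autoImplicit false

noncomputable section

namespace Summit.QuantumFields.BalabanUV.T4Continuum.NE7b.SupStepLineDerivatives

open MeasureTheory ProbabilityTheory Finset Real Metric Filter
open scoped BigOperators Topology
open SupLinePointwise (hasDerivAt_lineZ0 hasDerivAt_lineZ1 hasDerivAt_lineZ2 third_domination)
open SupEffectiveActionDerivative (integrable_domination mul_opBound_le_of_le)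
open SupFluctuationAPriori (integrable_exp_neg)

variable {ι : Type} [Fintype ι] [DecidableEq ι]

section Main

variable {Γ : Matrix ι ι ℝ} {γop : ℝ} {w w' w'' w₃ : ι → ℝ → ℝ} {κ₀ κ₁ κ₂ κ₃ τ δ θ : ℝ}

/-! ## §1. Measurability and the bound -/

omit [Fintype ι] [DecidableEq ι] in
/-- The four integrands along the line are measurable at every `t` (`w, w′, w″` continuous as derivatives exist; `w‴` measurable). [folklore] -/
theorem aestronglyMeasurable_line (μ : Measure (EuclideanSpace ℝ ι)) (Y : Finset ι) (hw' : ∀ x t, HasDerivAt (w x) (w' x t) t)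
    (hw'' : ∀ x t, HasDerivAt (w' x) (w'' x t) t) (hw₃ : ∀ x t, HasDerivAt (w'' x) (w₃ x t) t) (hw₃m : ∀ x, Measurable (w₃ x))
    (ψ₀ h : ι → ℝ) (t : ℝ) :
    AEStronglyMeasurable (fun ω : EuclideanSpace ℝ ι => exp (-(∑ x ∈ Y, w x (ω x + (ψ₀ x + t * h x))))) μ ∧
      AEStronglyMeasurable (fun ω : EuclideanSpace ℝ ι => exp (-(∑ x ∈ Y, w x (ω x + (ψ₀ x + t * h x)))) * -(∑ x ∈ Y, w' x (ω x + (ψ₀ x + t * h x)) * h x)) μ ∧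
      AEStronglyMeasurable (fun ω : EuclideanSpace ℝ ι => exp (-(∑ x ∈ Y, w x (ω x + (ψ₀ x + t * h x)))) * ((∑ x ∈ Y, w' x (ω x + (ψ₀ x + t * h x)) * h x) * (∑ x ∈ Y, w' x (ω x + (ψ₀ x + t * h x)) * h x) - (∑ x ∈ Y, w'' x (ω x + (ψ₀ x + t * h x)) * h x ^ 2))) μ ∧
      AEStronglyMeasurable (fun ω : EuclideanSpace ℝ ι =>
        exp (-(∑ x ∈ Y, w x (ω x + (ψ₀ x + t * h x)))) * (-((∑ x ∈ Y, w' x (ω x + (ψ₀ x + t * h x)) * h x) * (∑ x ∈ Y, w' x (ω x + (ψ₀ x + t * h x)) * h x) * (∑ x ∈ Y, w' x (ω x + (ψ₀ x + t * h x)) * h x)) + 3 * ((∑ x ∈ Y, w' x (ω x + (ψ₀ x + t * h x)) * h x) * (∑ x ∈ Y, w'' x (ω x + (ψ₀ x + t * h x)) * h x ^ 2)) - (∑ x ∈ Y, w₃ x (ω x + (ψ₀ x + t * h x)) * h x ^ 3))) μ := by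
  have hwm : ∀ x, Measurable (w x) := fun x => (continuous_iff_continuousAt.2 fun u => (hw' x u).continuousAt).measurable
  have hw'm : ∀ x, Measurable (w' x) := fun x => (continuous_iff_continuousAt.2 fun u => (hw'' x u).continuousAt).measurable
  have hw''m : ∀ x, Measurable (w'' x) := fun x => (continuous_iff_continuousAt.2 fun u => (hw₃ x u).continuousAt).measurable
  have hsite : ∀ x, Measurable fun ω : EuclideanSpace ℝ ι => (ω x + (ψ₀ x + t * h x)) := fun x =>
    (by fun_prop : Measurable fun ω : EuclideanSpace ℝ ι => ω x).add_const _
  have hV : Measurable fun ω : EuclideanSpace ℝ ι => ∑ x ∈ Y, w x (ω x + (ψ₀ x + t * h x)) :=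
    Finset.measurable_sum Y fun x _ => (hwm x).comp (hsite x)
  have hA : Measurable fun ω : EuclideanSpace ℝ ι => (∑ x ∈ Y, w' x (ω x + (ψ₀ x + t * h x)) * h x) :=
    Finset.measurable_sum Y fun x _ => ((hw'm x).comp (hsite x)).mul_const _
  have hB : Measurable fun ω : EuclideanSpace ℝ ι => (∑ x ∈ Y, w'' x (ω x + (ψ₀ x + t * h x)) * h x ^ 2) :=
    Finset.measurable_sum Y fun x _ => ((hw''m x).comp (hsite x)).mul_const _
  have hC : Measurable fun ω : EuclideanSpace ℝ ι => (∑ x ∈ Y, w₃ x (ω x + (ψ₀ x + t * h x)) * h x ^ 3) :=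
    Finset.measurable_sum Y fun x _ => ((hw₃m x).comp (hsite x)).mul_const _
  have hE : Measurable fun ω : EuclideanSpace ℝ ι => exp (-(∑ x ∈ Y, w x (ω x + (ψ₀ x + t * h x)))) := measurable_exp.comp hV.neg
  exact ⟨hE.aestronglyMeasurable, (hE.mul hA.neg).aestronglyMeasurable, (hE.mul ((hA.mul hA).sub hB)).aestronglyMeasurable,
    (hE.mul ((((hA.mul hA).mul hA).neg.add ((hA.mul hB).const_mul 3)).sub hC)).aestronglyMeasurable⟩

omit [Fintype ι] [DecidableEq ι] in
/-- **The three derivative integrands are under the dominator** on `|t − t₀| ≤ 1` ((336a) `third_domination`; `|A| ≤ T`, `|A·A − B| ≤ T`,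
`|−A³ + 3AB − C| ≤ T`). [folklore] -/
theorem norm_deriv_line_le (Y : Finset ι) (hκ₀ : 0 ≤ κ₀) (hκ₁ : 0 ≤ κ₁) (hτ : 0 < τ) (hδ : 0 < δ)
    (hstab : ∀ x, ∀ u : ℝ, -(κ₀ * u ^ 2) ≤ w x u) (hw'b : ∀ x u, |w' x u| ≤ κ₁ * |u|) (hκ₂ : 0 ≤ κ₂) (hw''b : ∀ x u, |w'' x u| ≤ κ₂)
    (hκ₃ : 0 ≤ κ₃) (hw₃b : ∀ x u, |w₃ x u| ≤ κ₃) (ω ψ₀ h : ι → ℝ) {t₀ t : ℝ} (ht : |t - t₀| ≤ 1) :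
    ‖exp (-(∑ x ∈ Y, w x (ω x + (ψ₀ x + t * h x)))) * -(∑ x ∈ Y, w' x (ω x + (ψ₀ x + t * h x)) * h x)‖ ≤
      exp (κ₀ * (1 + τ⁻¹) * (∑ x ∈ Y, (|ψ₀ x| + (|t₀| + 1) * |h x|) ^ 2)) *
        (4 * κ₁ ^ 3 * (6 * ((2 * δ) ^ 3)⁻¹ + ((∑ x ∈ Y, (|ψ₀ x| + (|t₀| + 1) * |h x|) ^ 2) + (∑ x ∈ Y, h x ^ 2) / 2) ^ 3) + 3 * κ₁ * κ₂ * (∑ x ∈ Y, h x ^ 2) * ((2 * δ)⁻¹ + ((∑ x ∈ Y, (|ψ₀ x| + (|t₀| + 1) * |h x|) ^ 2) + (∑ x ∈ Y, h x ^ 2) / 2)) + κ₃ * (∑ x ∈ Y, |h x| ^ 3) +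
          2 * κ₁ ^ 2 * (2 * ((2 * δ) ^ 2)⁻¹ + ((∑ x ∈ Y, (|ψ₀ x| + (|t₀| + 1) * |h x|) ^ 2) + (∑ x ∈ Y, h x ^ 2) / 2) ^ 2) + κ₂ * (∑ x ∈ Y, h x ^ 2) + κ₁ * ((2 * δ)⁻¹ + ((∑ x ∈ Y, (|ψ₀ x| + (|t₀| + 1) * |h x|) ^ 2) + (∑ x ∈ Y, h x ^ 2) / 2))) *
        exp ((2 * κ₀ * (1 + τ) + 4 * δ) * (∑ x ∈ Y, ω x ^ 2) / 2) ∧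
    ‖exp (-(∑ x ∈ Y, w x (ω x + (ψ₀ x + t * h x)))) * ((∑ x ∈ Y, w' x (ω x + (ψ₀ x + t * h x)) * h x) * (∑ x ∈ Y, w' x (ω x + (ψ₀ x + t * h x)) * h x) - (∑ x ∈ Y, w'' x (ω x + (ψ₀ x + t * h x)) * h x ^ 2))‖ ≤
      exp (κ₀ * (1 + τ⁻¹) * (∑ x ∈ Y, (|ψ₀ x| + (|t₀| + 1) * |h x|) ^ 2)) *
        (4 * κ₁ ^ 3 * (6 * ((2 * δ) ^ 3)⁻¹ + ((∑ x ∈ Y, (|ψ₀ x| + (|t₀| + 1) * |h x|) ^ 2) + (∑ x ∈ Y, h x ^ 2) / 2) ^ 3) + 3 * κ₁ * κ₂ * (∑ x ∈ Y, h x ^ 2) * ((2 * δ)⁻¹ + ((∑ x ∈ Y, (|ψ₀ x| + (|t₀| + 1) * |h x|) ^ 2) + (∑ x ∈ Y, h x ^ 2) / 2)) + κ₃ * (∑ x ∈ Y, |h x| ^ 3) +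
          2 * κ₁ ^ 2 * (2 * ((2 * δ) ^ 2)⁻¹ + ((∑ x ∈ Y, (|ψ₀ x| + (|t₀| + 1) * |h x|) ^ 2) + (∑ x ∈ Y, h x ^ 2) / 2) ^ 2) + κ₂ * (∑ x ∈ Y, h x ^ 2) + κ₁ * ((2 * δ)⁻¹ + ((∑ x ∈ Y, (|ψ₀ x| + (|t₀| + 1) * |h x|) ^ 2) + (∑ x ∈ Y, h x ^ 2) / 2))) *
        exp ((2 * κ₀ * (1 + τ) + 4 * δ) * (∑ x ∈ Y, ω x ^ 2) / 2) ∧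
    ‖exp (-(∑ x ∈ Y, w x (ω x + (ψ₀ x + t * h x)))) * (-((∑ x ∈ Y, w' x (ω x + (ψ₀ x + t * h x)) * h x) * (∑ x ∈ Y, w' x (ω x + (ψ₀ x + t * h x)) * h x) * (∑ x ∈ Y, w' x (ω x + (ψ₀ x + t * h x)) * h x)) + 3 * ((∑ x ∈ Y, w' x (ω x + (ψ₀ x + t * h x)) * h x) * (∑ x ∈ Y, w'' x (ω x + (ψ₀ x + t * h x)) * h x ^ 2)) - (∑ x ∈ Y, w₃ x (ω x + (ψ₀ x + t * h x)) * h x ^ 3))‖ ≤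
      exp (κ₀ * (1 + τ⁻¹) * (∑ x ∈ Y, (|ψ₀ x| + (|t₀| + 1) * |h x|) ^ 2)) *
        (4 * κ₁ ^ 3 * (6 * ((2 * δ) ^ 3)⁻¹ + ((∑ x ∈ Y, (|ψ₀ x| + (|t₀| + 1) * |h x|) ^ 2) + (∑ x ∈ Y, h x ^ 2) / 2) ^ 3) + 3 * κ₁ * κ₂ * (∑ x ∈ Y, h x ^ 2) * ((2 * δ)⁻¹ + ((∑ x ∈ Y, (|ψ₀ x| + (|t₀| + 1) * |h x|) ^ 2) + (∑ x ∈ Y, h x ^ 2) / 2)) + κ₃ * (∑ x ∈ Y, |h x| ^ 3) +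
          2 * κ₁ ^ 2 * (2 * ((2 * δ) ^ 2)⁻¹ + ((∑ x ∈ Y, (|ψ₀ x| + (|t₀| + 1) * |h x|) ^ 2) + (∑ x ∈ Y, h x ^ 2) / 2) ^ 2) + κ₂ * (∑ x ∈ Y, h x ^ 2) + κ₁ * ((2 * δ)⁻¹ + ((∑ x ∈ Y, (|ψ₀ x| + (|t₀| + 1) * |h x|) ^ 2) + (∑ x ∈ Y, h x ^ 2) / 2))) *
        exp ((2 * κ₀ * (1 + τ) + 4 * δ) * (∑ x ∈ Y, ω x ^ 2) / 2) := by
  have hdom := third_domination Y ω ψ₀ h hκ₀ hκ₁ hτ hδ hstab hw'b hκ₂ hw''b hκ₃ hw₃b ht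
  have hT0 : 0 ≤ |(∑ x ∈ Y, w' x (ω x + (ψ₀ x + t * h x)) * h x)| * |(∑ x ∈ Y, w' x (ω x + (ψ₀ x + t * h x)) * h x)| * |(∑ x ∈ Y, w' x (ω x + (ψ₀ x + t * h x)) * h x)| + 3 * (|(∑ x ∈ Y, w' x (ω x + (ψ₀ x + t * h x)) * h x)| * |(∑ x ∈ Y, w'' x (ω x + (ψ₀ x + t * h x)) * h x ^ 2)|) + |(∑ x ∈ Y, w₃ x (ω x + (ψ₀ x + t * h x)) * h x ^ 3)| +
      |(∑ x ∈ Y, w' x (ω x + (ψ₀ x + t * h x)) * h x)| * |(∑ x ∈ Y, w' x (ω x + (ψ₀ x + t * h x)) * h x)| + |(∑ x ∈ Y, w'' x (ω x + (ψ₀ x + t * h x)) * h x ^ 2)| := by positivity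
  have hT1 : 0 ≤ |(∑ x ∈ Y, w' x (ω x + (ψ₀ x + t * h x)) * h x)| * |(∑ x ∈ Y, w' x (ω x + (ψ₀ x + t * h x)) * h x)| * |(∑ x ∈ Y, w' x (ω x + (ψ₀ x + t * h x)) * h x)| + 3 * (|(∑ x ∈ Y, w' x (ω x + (ψ₀ x + t * h x)) * h x)| * |(∑ x ∈ Y, w'' x (ω x + (ψ₀ x + t * h x)) * h x ^ 2)|) + |(∑ x ∈ Y, w₃ x (ω x + (ψ₀ x + t * h x)) * h x ^ 3)| +
      |(∑ x ∈ Y, w' x (ω x + (ψ₀ x + t * h x)) * h x)| := by positivity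
  have hT2 : 0 ≤ |(∑ x ∈ Y, w' x (ω x + (ψ₀ x + t * h x)) * h x)| * |(∑ x ∈ Y, w' x (ω x + (ψ₀ x + t * h x)) * h x)| + |(∑ x ∈ Y, w'' x (ω x + (ψ₀ x + t * h x)) * h x ^ 2)| + |(∑ x ∈ Y, w' x (ω x + (ψ₀ x + t * h x)) * h x)| := by positivity
  have he : 0 ≤ exp (-(∑ x ∈ Y, w x (ω x + (ψ₀ x + t * h x)))) := (exp_pos _).le
  refine ⟨?_, ?_, ?_⟩
  · rw [norm_mul, norm_neg, Real.norm_of_nonneg he, Real.norm_eq_abs]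
    refine le_trans (mul_le_mul_of_nonneg_left ?_ he) hdom
    linarith
  · rw [norm_mul, Real.norm_of_nonneg he, Real.norm_eq_abs]
    refine le_trans (mul_le_mul_of_nonneg_left ?_ he) hdom
    refine (abs_sub _ _).trans ?_
    rw [abs_mul]
    linarith
  · rw [norm_mul, Real.norm_of_nonneg he, Real.norm_eq_abs]
    refine le_trans (mul_le_mul_of_nonneg_left ?_ he) hdom
    have t1 := abs_sub (-((∑ x ∈ Y, w' x (ω x + (ψ₀ x + t * h x)) * h x) * (∑ x ∈ Y, w' x (ω x + (ψ₀ x + t * h x)) * h x) * (∑ x ∈ Y, w' x (ω x + (ψ₀ x + t * h x)) * h x)) + 3 * ((∑ x ∈ Y, w' x (ω x + (ψ₀ x + t * h x)) * h x) * (∑ x ∈ Y, w'' x (ω x + (ψ₀ x + t * h x)) * h x ^ 2))) (∑ x ∈ Y, w₃ x (ω x + (ψ₀ x + t * h x)) * h x ^ 3)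
    have t2 := abs_add_le (-((∑ x ∈ Y, w' x (ω x + (ψ₀ x + t * h x)) * h x) * (∑ x ∈ Y, w' x (ω x + (ψ₀ x + t * h x)) * h x) * (∑ x ∈ Y, w' x (ω x + (ψ₀ x + t * h x)) * h x))) (3 * ((∑ x ∈ Y, w' x (ω x + (ψ₀ x + t * h x)) * h x) * (∑ x ∈ Y, w'' x (ω x + (ψ₀ x + t * h x)) * h x ^ 2)))
    have e3 : |-((∑ x ∈ Y, w' x (ω x + (ψ₀ x + t * h x)) * h x) * (∑ x ∈ Y, w' x (ω x + (ψ₀ x + t * h x)) * h x) * (∑ x ∈ Y, w' x (ω x + (ψ₀ x + t * h x)) * h x))| = |(∑ x ∈ Y, w' x (ω x + (ψ₀ x + t * h x)) * h x)| * |(∑ x ∈ Y, w' x (ω x + (ψ₀ x + t * h x)) * h x)| * |(∑ x ∈ Y, w' x (ω x + (ψ₀ x + t * h x)) * h x)| := by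
      rw [abs_neg, abs_mul, abs_mul]
    have e4 : |3 * ((∑ x ∈ Y, w' x (ω x + (ψ₀ x + t * h x)) * h x) * (∑ x ∈ Y, w'' x (ω x + (ψ₀ x + t * h x)) * h x ^ 2))| = 3 * (|(∑ x ∈ Y, w' x (ω x + (ψ₀ x + t * h x)) * h x)| * |(∑ x ∈ Y, w'' x (ω x + (ψ₀ x + t * h x)) * h x ^ 2)|) := by
      rw [abs_mul, abs_mul, abs_of_pos (by norm_num : (0 : ℝ) < 3)]
    linarith

/-! ## §2. THE END: the three dominated differentiations -/

/-- **`Z′(t₀) = ∫e^{−V}(−A)`** (and the derivative integrand is integrable): `Γ ⪰ 0`, `Γ ⪯ γ_op·1`, `C³` remainders with the four letters,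
`0 < τ`, `0 < δ`, `0 ≤ θ < 1`, `(2κ₀(1+τ)+4δ)γ_op ≤ θ`; at EVERY `t₀`. [folklore] -/
theorem hasDerivAt_lineZ (hΓ : Γ.PosSemidef) (hΓop : (γop • (1 : Matrix ι ι ℝ) - Γ).PosSemidef) (Y : Finset ι)
    (hw' : ∀ x t, HasDerivAt (w x) (w' x t) t) (hw'' : ∀ x t, HasDerivAt (w' x) (w'' x t) t) (hw₃ : ∀ x t, HasDerivAt (w'' x) (w₃ x t) t)
    (hw₃m : ∀ x, Measurable (w₃ x)) (hκ₀ : 0 ≤ κ₀) (hκ₁ : 0 ≤ κ₁) (hκ₂ : 0 ≤ κ₂) (hκ₃ : 0 ≤ κ₃) (hτ : 0 < τ) (hδ : 0 < δ) (hθ0 : 0 ≤ θ)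
    (hθ1 : θ < 1) (hκθ : (2 * κ₀ * (1 + τ) + 4 * δ) * γop ≤ θ) (hstab : ∀ x, ∀ u : ℝ, -(κ₀ * u ^ 2) ≤ w x u)
    (hw'b : ∀ x u, |w' x u| ≤ κ₁ * |u|) (hw''b : ∀ x u, |w'' x u| ≤ κ₂) (hw₃b : ∀ x u, |w₃ x u| ≤ κ₃) (ψ₀ h : ι → ℝ) (t₀ : ℝ) :
    Integrable (fun ω : EuclideanSpace ℝ ι => exp (-(∑ x ∈ Y, w x (ω x + (ψ₀ x + t₀ * h x)))) * -(∑ x ∈ Y, w' x (ω x + (ψ₀ x + t₀ * h x)) * h x)) (multivariateGaussian 0 Γ) ∧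
      HasDerivAt (fun t : ℝ => ∫ ω : EuclideanSpace ℝ ι, exp (-(∑ x ∈ Y, w x (ω x + (ψ₀ x + t * h x)))) ∂(multivariateGaussian 0 Γ))
        (∫ ω : EuclideanSpace ℝ ι, exp (-(∑ x ∈ Y, w x (ω x + (ψ₀ x + t₀ * h x)))) * -(∑ x ∈ Y, w' x (ω x + (ψ₀ x + t₀ * h x)) * h x) ∂(multivariateGaussian 0 Γ)) t₀ := by
  have hwm : ∀ x, Measurable (w x) := fun x => (continuous_iff_continuousAt.2 fun u => (hw' x u).continuousAt).measurable
  have hκθ₀ : 2 * κ₀ * (1 + τ) * γop ≤ θ :=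
    mul_opBound_le_of_le (a := 2 * κ₀ * (1 + τ)) (b := 2 * κ₀ * (1 + τ) + 4 * δ) (by positivity) (by linarith [hδ.le]) hθ0 hκθ
  have hint : Integrable (fun ω : EuclideanSpace ℝ ι => exp (-(∑ x ∈ Y, w x (ω x + (ψ₀ x + t₀ * h x))))) (multivariateGaussian 0 Γ) :=
    integrable_exp_neg hΓ hΓop Y w hwm hκ₀ hτ hθ1 hκθ₀ hstab (fun x => ψ₀ x + t₀ * h x)
  exact hasDerivAt_integral_of_dominated_loc_of_deriv_le (μ := (multivariateGaussian 0 Γ)) (x₀ := t₀) (s := closedBall t₀ 1)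
    (closedBall_mem_nhds t₀ one_pos)
    (Eventually.of_forall fun t => (aestronglyMeasurable_line (multivariateGaussian 0 Γ) Y hw' hw'' hw₃ hw₃m ψ₀ h t).1) hint
    (aestronglyMeasurable_line (multivariateGaussian 0 Γ) Y hw' hw'' hw₃ hw₃m ψ₀ h t₀).2.1
    (ae_of_all _ fun ω t ht => by
      rw [mem_closedBall, dist_eq_norm, Real.norm_eq_abs] at ht
      exact (norm_deriv_line_le Y hκ₀ hκ₁ hτ hδ hstab hw'b hκ₂ hw''b hκ₃ hw₃b (fun x => ω x) ψ₀ h ht).1)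
    (integrable_domination hΓ hΓop Y hκ₀ hτ hδ hθ1 hκθ _)
    (ae_of_all _ fun ω t _ => hasDerivAt_lineZ0 Y (fun x => ω x) ψ₀ h hw' t)

/-- **`(∫e^{−V}(−A))′(t₀) = ∫e^{−V}(A·A − B)`** (and the derivative integrand is integrable), under the same hypotheses. [folklore] -/
theorem hasDerivAt_lineZ' (hΓ : Γ.PosSemidef) (hΓop : (γop • (1 : Matrix ι ι ℝ) - Γ).PosSemidef) (Y : Finset ι)
    (hw' : ∀ x t, HasDerivAt (w x) (w' x t) t) (hw'' : ∀ x t, HasDerivAt (w' x) (w'' x t) t) (hw₃ : ∀ x t, HasDerivAt (w'' x) (w₃ x t) t)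
    (hw₃m : ∀ x, Measurable (w₃ x)) (hκ₀ : 0 ≤ κ₀) (hκ₁ : 0 ≤ κ₁) (hκ₂ : 0 ≤ κ₂) (hκ₃ : 0 ≤ κ₃) (hτ : 0 < τ) (hδ : 0 < δ) (hθ0 : 0 ≤ θ)
    (hθ1 : θ < 1) (hκθ : (2 * κ₀ * (1 + τ) + 4 * δ) * γop ≤ θ) (hstab : ∀ x, ∀ u : ℝ, -(κ₀ * u ^ 2) ≤ w x u)
    (hw'b : ∀ x u, |w' x u| ≤ κ₁ * |u|) (hw''b : ∀ x u, |w'' x u| ≤ κ₂) (hw₃b : ∀ x u, |w₃ x u| ≤ κ₃) (ψ₀ h : ι → ℝ) (t₀ : ℝ) :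
    Integrable (fun ω : EuclideanSpace ℝ ι => exp (-(∑ x ∈ Y, w x (ω x + (ψ₀ x + t₀ * h x)))) * ((∑ x ∈ Y, w' x (ω x + (ψ₀ x + t₀ * h x)) * h x) * (∑ x ∈ Y, w' x (ω x + (ψ₀ x + t₀ * h x)) * h x) - (∑ x ∈ Y, w'' x (ω x + (ψ₀ x + t₀ * h x)) * h x ^ 2))) (multivariateGaussian 0 Γ) ∧
      HasDerivAt (fun t : ℝ => ∫ ω : EuclideanSpace ℝ ι, exp (-(∑ x ∈ Y, w x (ω x + (ψ₀ x + t * h x)))) * -(∑ x ∈ Y, w' x (ω x + (ψ₀ x + t * h x)) * h x) ∂(multivariateGaussian 0 Γ))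
        (∫ ω : EuclideanSpace ℝ ι, exp (-(∑ x ∈ Y, w x (ω x + (ψ₀ x + t₀ * h x)))) * ((∑ x ∈ Y, w' x (ω x + (ψ₀ x + t₀ * h x)) * h x) * (∑ x ∈ Y, w' x (ω x + (ψ₀ x + t₀ * h x)) * h x) - (∑ x ∈ Y, w'' x (ω x + (ψ₀ x + t₀ * h x)) * h x ^ 2)) ∂(multivariateGaussian 0 Γ)) t₀ := by
  have hint := (hasDerivAt_lineZ hΓ hΓop Y hw' hw'' hw₃ hw₃m hκ₀ hκ₁ hκ₂ hκ₃ hτ hδ hθ0 hθ1 hκθ hstab hw'b hw''b hw₃b ψ₀ h t₀).1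
  exact hasDerivAt_integral_of_dominated_loc_of_deriv_le (μ := (multivariateGaussian 0 Γ)) (x₀ := t₀) (s := closedBall t₀ 1)
    (closedBall_mem_nhds t₀ one_pos)
    (Eventually.of_forall fun t => (aestronglyMeasurable_line (multivariateGaussian 0 Γ) Y hw' hw'' hw₃ hw₃m ψ₀ h t).2.1) hint
    (aestronglyMeasurable_line (multivariateGaussian 0 Γ) Y hw' hw'' hw₃ hw₃m ψ₀ h t₀).2.2.1
    (ae_of_all _ fun ω t ht => by
      rw [mem_closedBall, dist_eq_norm, Real.norm_eq_abs] at ht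
      exact (norm_deriv_line_le Y hκ₀ hκ₁ hτ hδ hstab hw'b hκ₂ hw''b hκ₃ hw₃b (fun x => ω x) ψ₀ h ht).2.1)
    (integrable_domination hΓ hΓop Y hκ₀ hτ hδ hθ1 hκθ _)
    (ae_of_all _ fun ω t _ => hasDerivAt_lineZ1 Y (fun x => ω x) ψ₀ h hw' hw'' t)

/-- **`(∫e^{−V}(A·A − B))′(t₀) = ∫e^{−V}(−A·A·A + 3AB − C)`** (and the derivative integrand is integrable), under the same hypotheses —
with `hasDerivAt_lineZ`, `hasDerivAt_lineZ'`: `t ↦ Z(ψ₀ + th)` is `C³` with `Z‴(t₀) = ∫e^{−V}(−A³ + 3AB − C)dN(0,Γ)`. [folklore] -/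
theorem hasDerivAt_lineZ'' (hΓ : Γ.PosSemidef) (hΓop : (γop • (1 : Matrix ι ι ℝ) - Γ).PosSemidef) (Y : Finset ι)
    (hw' : ∀ x t, HasDerivAt (w x) (w' x t) t) (hw'' : ∀ x t, HasDerivAt (w' x) (w'' x t) t) (hw₃ : ∀ x t, HasDerivAt (w'' x) (w₃ x t) t)
    (hw₃m : ∀ x, Measurable (w₃ x)) (hκ₀ : 0 ≤ κ₀) (hκ₁ : 0 ≤ κ₁) (hκ₂ : 0 ≤ κ₂) (hκ₃ : 0 ≤ κ₃) (hτ : 0 < τ) (hδ : 0 < δ) (hθ0 : 0 ≤ θ)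
    (hθ1 : θ < 1) (hκθ : (2 * κ₀ * (1 + τ) + 4 * δ) * γop ≤ θ) (hstab : ∀ x, ∀ u : ℝ, -(κ₀ * u ^ 2) ≤ w x u)
    (hw'b : ∀ x u, |w' x u| ≤ κ₁ * |u|) (hw''b : ∀ x u, |w'' x u| ≤ κ₂) (hw₃b : ∀ x u, |w₃ x u| ≤ κ₃) (ψ₀ h : ι → ℝ) (t₀ : ℝ) :
    Integrable (fun ω : EuclideanSpace ℝ ι =>
        exp (-(∑ x ∈ Y, w x (ω x + (ψ₀ x + t₀ * h x)))) * (-((∑ x ∈ Y, w' x (ω x + (ψ₀ x + t₀ * h x)) * h x) * (∑ x ∈ Y, w' x (ω x + (ψ₀ x + t₀ * h x)) * h x) * (∑ x ∈ Y, w' x (ω x + (ψ₀ x + t₀ * h x)) * h x)) + 3 * ((∑ x ∈ Y, w' x (ω x + (ψ₀ x + t₀ * h x)) * h x) * (∑ x ∈ Y, w'' x (ω x + (ψ₀ x + t₀ * h x)) * h x ^ 2)) - (∑ x ∈ Y, w₃ x (ω x + (ψ₀ x + t₀ * h x)) * h x ^ 3))) (multivariateGaussian 0 Γ) ∧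
      HasDerivAt (fun t : ℝ => ∫ ω : EuclideanSpace ℝ ι, exp (-(∑ x ∈ Y, w x (ω x + (ψ₀ x + t * h x)))) * ((∑ x ∈ Y, w' x (ω x + (ψ₀ x + t * h x)) * h x) * (∑ x ∈ Y, w' x (ω x + (ψ₀ x + t * h x)) * h x) - (∑ x ∈ Y, w'' x (ω x + (ψ₀ x + t * h x)) * h x ^ 2)) ∂(multivariateGaussian 0 Γ))
        (∫ ω : EuclideanSpace ℝ ι,
          exp (-(∑ x ∈ Y, w x (ω x + (ψ₀ x + t₀ * h x)))) * (-((∑ x ∈ Y, w' x (ω x + (ψ₀ x + t₀ * h x)) * h x) * (∑ x ∈ Y, w' x (ω x + (ψ₀ x + t₀ * h x)) * h x) * (∑ x ∈ Y, w' x (ω x + (ψ₀ x + t₀ * h x)) * h x)) + 3 * ((∑ x ∈ Y, w' x (ω x + (ψ₀ x + t₀ * h x)) * h x) * (∑ x ∈ Y, w'' x (ω x + (ψ₀ x + t₀ * h x)) * h x ^ 2)) - (∑ x ∈ Y, w₃ x (ω x + (ψ₀ x + t₀ * h x)) * h x ^ 3)) ∂(multivariateGaussian 0 Γ)) t₀ :=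 by
  have hint := (hasDerivAt_lineZ' hΓ hΓop Y hw' hw'' hw₃ hw₃m hκ₀ hκ₁ hκ₂ hκ₃ hτ hδ hθ0 hθ1 hκθ hstab hw'b hw''b hw₃b ψ₀ h t₀).1
  exact hasDerivAt_integral_of_dominated_loc_of_deriv_le (μ := (multivariateGaussian 0 Γ)) (x₀ := t₀) (s := closedBall t₀ 1)
    (closedBall_mem_nhds t₀ one_pos)
    (Eventually.of_forall fun t => (aestronglyMeasurable_line (multivariateGaussian 0 Γ) Y hw' hw'' hw₃ hw₃m ψ₀ h t).2.2.1) hint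
    (aestronglyMeasurable_line (multivariateGaussian 0 Γ) Y hw' hw'' hw₃ hw₃m ψ₀ h t₀).2.2.2
    (ae_of_all _ fun ω t ht => by
      rw [mem_closedBall, dist_eq_norm, Real.norm_eq_abs] at ht
      exact (norm_deriv_line_le Y hκ₀ hκ₁ hτ hδ hstab hw'b hκ₂ hw''b hκ₃ hw₃b (fun x => ω x) ψ₀ h ht).2.2)
    (integrable_domination hΓ hΓop Y hκ₀ hτ hδ hθ1 hκθ _)
    (ae_of_all _ fun ω t _ => hasDerivAt_lineZ2 Y (fun x => ω x) ψ₀ h hw' hw'' hw₃ t)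

end Main

/-! ## §3. Toy -/

/-- Toy (§1's bookkeeping): `|a·a − b| ≤ |a|·|a| + |b|`. -/
example (a b : ℝ) : |a * a - b| ≤ |a| * |a| + |b| := by
  refine (abs_sub _ _).trans ?_
  rw [abs_mul]

end Summit.QuantumFields.BalabanUV.T4Continuum.NE7b.SupStepLineDerivatives
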